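import Mathlib
import Summits.Ventures.PercRepro2.CrossAPrimeA2V
import Summits.Ventures.PercRepro2.CrossAPrimeA2Route

/-!
# The ν-form of the crux is the product of the two BHK deficits plus the half-PA surplus
(blind cell PercRepro2, p5 g38; `proofs/subclaims/S4-HARDSTEP.md` §2.4 (s) addendum 49)

With `Z = P(Q)`, `Zv = P(Q, vL)` and `ν = Zv / Z = P(a₁ ↔ v | Q)` — the constant of the ν-form of
S4 addendum 40, the sharpest form of the conjecture — the identity

  `Z·Zv·crossC(p; ν) = (Z·xv − Zv·x)·(Z·yv − Zv·y) + Z²·(2·Zv·Dv − xv·yv)`  (**`crossC_nu_mul_eq`**)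

holds for every weight vector.  Its first term is the PRODUCT OF THE TWO BHK DEFICITS
`Z·xv − Zv·x ≤ 0`, `Z·yv − Zv·y ≤ 0` (`bhk_vL_avoid_single`: the cross-cluster repulsion of `o ∈ K`
resp. `b ∈ K` against `a₁ ↔ v` under `Q`), hence nonnegative; the second is `Z²` times the
HALF-PA SURPLUS GIVEN `a₁ ↔ v`: `2·P(o, b ∈ K | Q, vL) − P(o ∈ K | Q, vL)·P(b ∈ K | Q, vL)`.  So

* **`crossC_nu_nonneg_of_halfPA`**: `xv·yv ≤ 2·Zv·Dv` (half positive association of `{o ∈ K}`,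
  `{b ∈ K}` given `a₁ ↔ v`) implies `0 ≤ crossC(p; ν)`; by the identity, the ν-form holds exactly
  when the half-PA deficit `Z²·(xv·yv − 2·Zv·Dv)` is paid by the product of the BHK deficits
  (the A-picture of addendum 40: `2E₁[t] − E₁[x]E₁[y] + (1 − ν)²·Δx·Δy ≥ 0`).

Half-PA fails in the two-route hard case (addendum 40: `E₁[t] = 0`), so the corollary is a
sufficient condition only.  Own work; standard axioms.
-/

namespace Summit.Ventures.PercRepro2

open LeafRowPendantRootSO CrossAPrimeA2Route CrossAPrimeA2V

namespace CrossAPrimeNuDeficits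

section Identity

variable {V : Type*} {E : Type*} [Fintype E] [DecidableEq E] {R : Type*} [Field R]
variable {ends : E → Sym2 V}

/-- **The ν-form identity**: `Z·Zv·crossC(p; Zv/Z) = (Z·xv − Zv·x)(Z·yv − Zv·y) + Z²(2·Zv·Dv − xv·yv)`
whenever `Z ≠ 0`. -/
theorem crossC_nu_mul_eq (p : E → R) (o a₁ a₂ v b : V)
    (hZ : prob p (avoidAll ends a₂ {a₁}) ≠ 0) :
    prob p (avoidAll ends a₂ {a₁}) * prob p (avoidAll ends a₂ {a₁} ∩ connEvent ends a₁ v) *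
        crossC p (prob p (avoidAll ends a₂ {a₁} ∩ connEvent ends a₁ v) /
          prob p (avoidAll ends a₂ {a₁})) ends o a₁ a₂ v b =
      (prob p (avoidAll ends a₂ {a₁}) *
            prob p (avoidAll ends a₂ {a₁} ∩ (connEvent ends a₁ v ∩ connEvent ends a₂ o)) -
          prob p (avoidAll ends a₂ {a₁} ∩ connEvent ends a₁ v) *
            prob p (avoidAll ends a₂ {a₁} ∩ connEvent ends a₂ o)) *
        (prob p (avoidAll ends a₂ {a₁}) *
            prob p (avoidAll ends a₂ {a₁} ∩ (connEvent ends a₁ v ∩ connEvent ends a₂ b)) -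
          prob p (avoidAll ends a₂ {a₁} ∩ connEvent ends a₁ v) *
            prob p (avoidAll ends a₂ {a₁} ∩ connEvent ends a₂ b)) +
      prob p (avoidAll ends a₂ {a₁}) ^ 2 *
        (2 * prob p (avoidAll ends a₂ {a₁} ∩ connEvent ends a₁ v) *
            prob p (avoidAll ends a₂ {a₁} ∩
              (connEvent ends a₁ v ∩ (connEvent ends a₂ o ∩ connEvent ends a₂ b))) -
          prob p (avoidAll ends a₂ {a₁} ∩ (connEvent ends a₁ v ∩ connEvent ends a₂ o)) *
            prob p (avoidAll ends a₂ {a₁} ∩ (connEvent ends a₁ v ∩ connEvent ends a₂ b))) := by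
  unfold crossC
  field_simp
  ring

end Identity

section Signs

variable {V : Type*} {E : Type*} [Fintype E] [DecidableEq E] [Fintype V] [DecidableEq V]
  {R : Type*} [Field R] [LinearOrder R] [IsStrictOrderedRing R]
variable {ends : E → Sym2 V}

/-- **The ν-form from half positive association given `a₁ ↔ v`**: if `xv·yv ≤ 2·Zv·Dv` then
`0 ≤ crossC(p; ν)`, `ν = Zv / Z` (`Z > 0`). -/
theorem crossC_nu_nonneg_of_halfPA {p : E → R} (hp : IsProbVec p) (o a₁ a₂ v b : V)
    (hZ : 0 < prob p (avoidAll ends a₂ {a₁}))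
    (hhalf : prob p (avoidAll ends a₂ {a₁} ∩ (connEvent ends a₁ v ∩ connEvent ends a₂ o)) *
        prob p (avoidAll ends a₂ {a₁} ∩ (connEvent ends a₁ v ∩ connEvent ends a₂ b)) ≤
      2 * prob p (avoidAll ends a₂ {a₁} ∩ connEvent ends a₁ v) *
        prob p (avoidAll ends a₂ {a₁} ∩
          (connEvent ends a₁ v ∩ (connEvent ends a₂ o ∩ connEvent ends a₂ b)))) :
    0 ≤ crossC p (prob p (avoidAll ends a₂ {a₁} ∩ connEvent ends a₁ v) /
      prob p (avoidAll ends a₂ {a₁})) ends o a₁ a₂ v b := by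
  have hZv : 0 ≤ prob p (avoidAll ends a₂ {a₁} ∩ connEvent ends a₁ v) := prob_nonneg hp _
  rcases hZv.lt_or_eq with hZv | hZv
  · have hid := crossC_nu_mul_eq p o a₁ a₂ v b hZ.ne'
    have hx := bhk_vL_avoid_single (ends := ends) p hp a₁ a₂ v o
    have hy := bhk_vL_avoid_single (ends := ends) p hp a₁ a₂ v b
    have h1 : 0 ≤ (prob p (avoidAll ends a₂ {a₁}) *
          prob p (avoidAll ends a₂ {a₁} ∩ (connEvent ends a₁ v ∩ connEvent ends a₂ o)) -
        prob p (avoidAll ends a₂ {a₁} ∩ connEvent ends a₁ v) *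
          prob p (avoidAll ends a₂ {a₁} ∩ connEvent ends a₂ o)) *
        (prob p (avoidAll ends a₂ {a₁}) *
            prob p (avoidAll ends a₂ {a₁} ∩ (connEvent ends a₁ v ∩ connEvent ends a₂ b)) -
          prob p (avoidAll ends a₂ {a₁} ∩ connEvent ends a₁ v) *
            prob p (avoidAll ends a₂ {a₁} ∩ connEvent ends a₂ b)) := by
      apply mul_nonneg_of_nonpos_of_nonpos <;> linarith
    have h2 : 0 ≤ prob p (avoidAll ends a₂ {a₁}) ^ 2 *
        (2 * prob p (avoidAll ends a₂ {a₁} ∩ connEvent ends a₁ v) *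
            prob p (avoidAll ends a₂ {a₁} ∩
              (connEvent ends a₁ v ∩ (connEvent ends a₂ o ∩ connEvent ends a₂ b))) -
          prob p (avoidAll ends a₂ {a₁} ∩ (connEvent ends a₁ v ∩ connEvent ends a₂ o)) *
            prob p (avoidAll ends a₂ {a₁} ∩ (connEvent ends a₁ v ∩ connEvent ends a₂ b))) :=
      mul_nonneg (sq_nonneg _) (by linarith)
    have hprod : 0 ≤ prob p (avoidAll ends a₂ {a₁}) *
        prob p (avoidAll ends a₂ {a₁} ∩ connEvent ends a₁ v) *
        crossC p (prob p (avoidAll ends a₂ {a₁} ∩ connEvent ends a₁ v) /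
          prob p (avoidAll ends a₂ {a₁})) ends o a₁ a₂ v b := by
      rw [hid]
      exact add_nonneg h1 h2
    exact nonneg_of_mul_nonneg_right hprod (mul_pos hZ hZv)
  · -- `Zv = 0`: every `v`-mass vanishes and `crossC(p; 0) = 0`
    have hZv' : prob p (avoidAll ends a₂ {a₁} ∩ connEvent ends a₁ v) = 0 := hZv.symm
    have hxv : prob p (avoidAll ends a₂ {a₁} ∩ (connEvent ends a₁ v ∩ connEvent ends a₂ o)) = 0 :=
      le_antisymm (by
        rw [← hZv']
        exact prob_mono hp (by
          intro ω hω
          exact ⟨hω.1, hω.2.1⟩)) (prob_nonneg hp _)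
    have hyv : prob p (avoidAll ends a₂ {a₁} ∩ (connEvent ends a₁ v ∩ connEvent ends a₂ b)) = 0 :=
      le_antisymm (by
        rw [← hZv']
        exact prob_mono hp (by
          intro ω hω
          exact ⟨hω.1, hω.2.1⟩)) (prob_nonneg hp _)
    have hDv : prob p (avoidAll ends a₂ {a₁} ∩
        (connEvent ends a₁ v ∩ (connEvent ends a₂ o ∩ connEvent ends a₂ b))) = 0 :=
      le_antisymm (by
        rw [← hZv']
        exact prob_mono hp (by
          intro ω hω
          exact ⟨hω.1, hω.2.1⟩)) (prob_nonneg hp _)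
    unfold crossC
    rw [hZv', hxv, hyv, hDv]
    simp

end Signs

end CrossAPrimeNuDeficits

end Summit.Ventures.PercRepro2
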